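import Literature.NumberTheory.Sieve.ThetaFixedLattice
import HarnessLib

/-!
# `Θ_{Ω'}(χ)` over the totally positive principal prime ideals of norm `≤ M^d`

Topic `Literature/NumberTheory/Sieve`, sub-namespace `ThetaUnits` (continued). For the partial
summation against prime-ideal counting functions (Mitsui 1956 §3) the index set `Pset M` of
`ThetaIdealFibres` (prime ideals having a prime generator INSIDE the cube) is replaced by the
canonical finite set `PPset M` of prime ideals `𝔭` with a totally positive generator
(`IsPosPrincipal`, `posGen` of `ConeWeylSums`) and `N𝔭 ≤ M^d`; the extra ideals contribute `0`,
and the value of the expansion does not depend on the chosen totally positive generator: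

* `PPset M`, `Pset_subset_PPset`;
* `tsum_Fsum_unit_mul` — `∑'_η F(η; uω) = ∑'_η F(η; ω)` for `u ∈ U⁺`;
* `Fsum_eq_zero_of_span_notMem` — off `Pset M` every term vanishes;
* **`theta_eq_sum_PPset`** — `Θ_{Ω'}(χ) = ∑_{𝔭 ∈ PPset M} ∑'_{η ∈ U⁺} Ω'(η ω_𝔭) χ(η ω_𝔭)`, `ω_𝔭 = posGen 𝔭`;
* **`theta_PPset_expansion`** — `Θ_{Ω'}(χ) = ∑_{𝔭 ∈ PPset M} ∑'_k ĉ(k, t_𝔭) Ξ_k(ω_𝔭)`;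
* `toTH_fst_eq_log_absNorm` — `t(β) = log N(β) / d`.

## References

* T. Mitsui, Jap. J. Math. 26 (1956), §3. [cite: Mitsui1956, §3]
* J. Hinz, Acta Arith. 51 (1988), §2. [cite: Hinz1988, §2]
-/

noncomputable section

open NumberField NumberField.InfinitePlace NumberField.Units NumberField.Units.dirichletUnitTheorem
  Literature.NumberTheory.LFunctions Literature.NumberTheory.LFunctions.HeckeCone
  Literature.NumberTheory.LFunctions.AbelianDensity
  Literature.NumberTheory.Sieve.UnitKernel Literature.NumberTheory.Sieve.UnitPeriodic
  Literature.Algebra.EuclideanLattices.LatticePeriodic Module MeasureTheory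
  Literature.NumberTheory.Sieve.NumberFieldLS Literature.NumberTheory.Sieve.SmoothTypeOne
  Literature.NumberTheory.Sieve.BoxPrimes Literature.NumberTheory.Sieve.TypeTwoBlock
  Literature.NumberTheory.Sieve.TypeTwoReparam Literature.NumberTheory.Sieve.SmoothSmallModuli
open scoped Classical

namespace Literature.NumberTheory.Sieve.ThetaUnits

variable {K : Type*} [Field K] [NumberField K] [IsTotallyReal K]

local notation "RP" => {w : InfinitePlace K // IsReal w}
local notation "rkE" => finrank ℝ (logSpace K)
local notation "d" => Module.finrank ℚ K

/-! ## Norms of principal ideals and the `t` coordinate -/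

/-- `∏_w w(β) = N(span{β})` (totally real `K`). [folklore] -/
theorem prod_apply_eq_absNorm (β : 𝓞 K) :
    ∏ w : InfinitePlace K, w (β : K) = (Ideal.absNorm (Ideal.span ({β} : Set (𝓞 K))) : ℝ) := by
  rw [CastilloEtAl2015.absNorm_span_singleton_real]
  have h := prod_eq_abs_norm (β : K)
  have h2 : ∏ w : InfinitePlace K, w (β : K) ^ mult w = ∏ w : InfinitePlace K, w (β : K) :=
    Finset.prod_congr rfl fun w _ => by rw [mult, if_pos (IsTotallyReal.isReal w), pow_one]
  rw [← h2, h]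
  push_cast
  rfl

/-- **`t(β) = log N(β) / d`**: the norm coordinate of `logVec β`. [folklore] -/
theorem toTH_fst_eq_log_absNorm {β : 𝓞 K} (hβ : β ≠ 0) :
    (toTH K (logVec K (β : K))).1 = Real.log (Ideal.absNorm (Ideal.span ({β} : Set (𝓞 K))) : ℝ) / d := by
  simp only [toTH]
  congr 1
  rw [← prod_apply_eq_absNorm, Real.log_prod]
  · refine Finset.sum_congr rfl fun w _ => ?_
    rw [mult, if_pos (IsTotallyReal.isReal w)]
    simp [logVec]
  · intro w _
    exact ((map_ne_zero w).2 (by exact_mod_cast hβ))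

/-! ## The canonical index set -/

variable (K) in
/-- `PPset M`: the prime ideals with a totally positive generator and norm `≤ M^d`. [folklore] -/
def PPset (M : ℝ) : Finset (Ideal (𝓞 K)) :=
  (Ideal.finite_setOf_absNorm_le (S := 𝓞 K) ⌊M ^ d⌋₊).toFinset.filter fun I => IsPosPrincipal K I ∧ I.IsPrime

omit [IsTotallyReal K] in
/-- Membership in `PPset`. [folklore] -/
theorem mem_PPset {M : ℝ} {I : Ideal (𝓞 K)} :
    I ∈ PPset K M ↔ Ideal.absNorm I ≤ ⌊M ^ d⌋₊ ∧ IsPosPrincipal K I ∧ I.IsPrime := by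
  rw [PPset, Finset.mem_filter, Set.Finite.mem_toFinset, Set.mem_setOf_eq]

/-- **`Pset M ⊆ PPset M`.** [folklore] -/
theorem Pset_subset_PPset (M : ℝ) : Pset (K := K) M ⊆ PPset K M := by
  intro 𝔭 h𝔭
  obtain ⟨α, hα, rfl⟩ := Finset.mem_image.1 h𝔭
  obtain ⟨hαc, hαp⟩ := Finset.mem_filter.1 hα
  have hα0 : α ≠ 0 := hαp.ne_zero
  have hpos := isTotPos_of_mem_cubeF hαc
  refine mem_PPset.2 ⟨?_, ⟨α, hα0, hpos, rfl⟩, (Ideal.span_singleton_prime hα0).2 hαp⟩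
  refine Nat.le_floor ?_
  rw [← prod_apply_eq_absNorm]
  have hbox := (mem_box₀_iff_remb.1 (mem_cubeF.1 hαc))
  calc ∏ w : InfinitePlace K, w (α : K) = ∏ w : RP, remb K (α : K) w := by
        rw [Finset.prod_subtype (Finset.univ : Finset (InfinitePlace K)) (p := fun w : InfinitePlace K => IsReal w)
          (fun w => by simp [IsTotallyReal.isReal w]) (fun w : InfinitePlace K => w (α : K))]
        refine Finset.prod_congr rfl fun w _ => ?_
        rw [← abs_remb, abs_of_pos (hbox w).1]
    _ ≤ ∏ _w : RP, M := Finset.prod_le_prod (fun w _ => (hbox w).1.le) fun w _ => (hbox w).2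
    _ = M ^ d := by rw [Finset.prod_const, Finset.card_univ, SmoothCoset.card_RP_eq]

/-! ## Generator independence and vanishing off `Pset` -/

variable {𝔣 : Ideal (𝓞 K)} (χ : AddChar (Additive ((𝓞 K ⧸ 𝔣)ˣ)) ℂ)

omit [IsTotallyReal K] in
/-- **`∑'_η F(η; uω) = ∑'_η F(η; ω)`** for a totally positive unit `u`. [folklore] -/
theorem tsum_Fsum_unit_mul (kf : RP → ℝ → ℝ) (M : ℝ) (u : posUnits K) (ω : 𝓞 K) :
    ∑' η : posUnits K, Fsum χ kf M ((((u : posUnits K) : (𝓞 K)ˣ) : 𝓞 K) * ω) η = ∑' η : posUnits K, Fsum χ kf M ω η := by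
  rw [← (Equiv.mulRight u).tsum_eq (fun η => Fsum χ kf M ω η)]
  refine tsum_congr fun η => ?_
  unfold Fsum
  simp only [Equiv.coe_mulRight, Subgroup.coe_mul, Units.val_mul]
  rw [mul_assoc]

/-- **Off `Pset M` every term vanishes**: if `ω ≫ 0` is a prime element with `(ω) ∉ Pset M` then
`F(η; ω) = 0` for all `η ∈ U⁺` (`M > 0`, profiles vanishing on `(0,∞)`). [folklore] -/
theorem Fsum_eq_zero_of_span_notMem {kf : RP → ℝ → ℝ} (hhi : ∀ w v, 0 < v → kf w v = 0) {M : ℝ} (hM : 0 < M)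
    {ω : 𝓞 K} (hωp : Prime ω) (hωpos : NumberField.IsTotPos K (ω : K)) (hnot : Ideal.span {ω} ∉ Pset (K := K) M)
    (η : posUnits K) : Fsum χ kf M ω η = 0 := by
  by_contra hne
  apply hnot
  have hw : weightΩfam K kf M ((((η : posUnits K) : (𝓞 K)ˣ) : 𝓞 K) * ω) ≠ 0 := fun h0 => hne (by unfold Fsum; rw [h0, zero_mul])
  have hpos : NumberField.IsTotPos K (((((η : posUnits K) : (𝓞 K)ˣ) : 𝓞 K) * ω : 𝓞 K) : K) := by
    push_cast; exact (mem_posUnits_iff.1 η.2).mul hωpos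
  have hcube := mem_cubeF_of_weightΩfam_ne_zero hhi hM hpos hw
  have hassoc : Associated ω ((((η : posUnits K) : (𝓞 K)ˣ) : 𝓞 K) * ω) := ⟨((η : posUnits K) : (𝓞 K)ˣ), by rw [mul_comm]⟩
  refine Finset.mem_image.2 ⟨(((η : posUnits K) : (𝓞 K)ˣ) : 𝓞 K) * ω, Finset.mem_filter.2 ⟨hcube, hassoc.prime hωp⟩, ?_⟩
  exact (Ideal.span_singleton_eq_span_singleton.2 hassoc).symm

/-! ## `Θ` over `PPset` -/

/-- **`Θ_{Ω'}(χ) = ∑_{𝔭 ∈ PPset M} ∑'_{η ∈ U⁺} Ω'(η ω_𝔭) χ(η ω_𝔭)`**, `ω_𝔭 = posGen 𝔭`.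
[cite: Mitsui1956, §3] -/
theorem theta_eq_sum_PPset {kf : RP → ℝ → ℝ} (hhi : ∀ w v, 0 < v → kf w v = 0) {M : ℝ} (hM : 0 < M) :
    theta K kf M χ = ∑ 𝔭 ∈ PPset K M, ∑' η : posUnits K, Fsum χ kf M (posGen 𝔭) η := by
  rw [theta_eq_sum_ideals χ hhi hM]
  -- replace `gen 𝔭` by `posGen 𝔭` on `Pset`
  have hgen : ∀ 𝔭 ∈ Pset (K := K) M, ∑' η : posUnits K, Fsum χ kf M (gen M 𝔭) η = ∑' η : posUnits K, Fsum χ kf M (posGen 𝔭) η := by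
    intro 𝔭 h𝔭
    obtain ⟨hgenT, hspan⟩ := gen_spec h𝔭
    obtain ⟨hgc, hgp⟩ := Finset.mem_filter.1 hgenT
    have hpp : IsPosPrincipal K 𝔭 := ⟨gen M 𝔭, hgp.ne_zero, isTotPos_of_mem_cubeF hgc, hspan.symm⟩
    obtain ⟨h0, hpos, heq⟩ := posGen_spec hpp
    -- `gen 𝔭 = u · posGen 𝔭` with `u ∈ U⁺`
    have hsp : Ideal.span {posGen 𝔭} = Ideal.span {gen M 𝔭} := by rw [← heq, hspan]
    obtain ⟨u, hu⟩ := Ideal.span_singleton_eq_span_singleton.1 hsp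
    -- `posGen 𝔭 * u = gen 𝔭`
    have hupos : u ∈ posUnits K := mem_posUnits_of_mul_eq hpos (isTotPos_of_mem_cubeF hgc) (by rw [mul_comm]; exact hu)
    rw [← tsum_Fsum_unit_mul χ kf M ⟨u, hupos⟩ (posGen 𝔭)]
    congr 2
    rw [← hu, mul_comm]
  rw [Finset.sum_congr rfl hgen]
  -- extend the sum from `Pset` to `PPset`
  refine Finset.sum_subset (Pset_subset_PPset M) fun 𝔭 h𝔭 hnot => ?_
  obtain ⟨-, hpp, hprime⟩ := mem_PPset.1 h𝔭
  obtain ⟨h0, hpos, heq⟩ := posGen_spec hpp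
  have hωp : Prime (posGen 𝔭) := (Ideal.span_singleton_prime h0).1 (heq ▸ hprime)
  rw [heq] at hnot
  exact (tsum_congr fun η => Fsum_eq_zero_of_span_notMem χ hhi hM hωp hpos hnot η).trans tsum_zero

/-- **`Θ_{Ω'}(χ) = ∑_{𝔭 ∈ PPset M} ∑'_k ĉ(k, t_𝔭) Ξ_k(ω_𝔭)`**, `ω_𝔭 = posGen 𝔭` (`𝔣 ≠ 0`, `M > 0`,
smooth profiles supported in `[a − log 2, 0]`). [cite: Mitsui1956, §3] -/
theorem theta_PPset_expansion [Finite (𝓞 K ⧸ 𝔣)] {kf : RP → ℝ → ℝ} (hk : ∀ w, ContDiff ℝ (⊤ : ℕ∞) (kf w)) {a : ℝ}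
    (hlo : ∀ w v, v < a - Real.log 2 → kf w v = 0) (hhi : ∀ w v, 0 < v → kf w v = 0) {M : ℝ} (hM : 0 < M) :
    theta K kf M χ = ∑ 𝔭 ∈ PPset K M, ∑' k : Fin rkE → ℤ,
      coeffF χ kf M (toTH K (logVec K (posGen 𝔭 : K))).1 k * XiGen χ k (posGen 𝔭) := by
  rw [theta_eq_sum_PPset χ hhi hM]
  refine Finset.sum_congr rfl fun 𝔭 h𝔭 => ?_
  have h0 : posGen 𝔭 ≠ 0 := (posGen_spec (mem_PPset.1 h𝔭).2.1).1
  exact ((hasSum_ideal_term χ hk hlo hhi M h0).tsum_eq).symm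

/-- The `t` coordinate on `PPset`: `t_𝔭 = log N𝔭 / d`. [folklore] -/
theorem toTH_fst_posGen {M : ℝ} {𝔭 : Ideal (𝓞 K)} (h𝔭 : 𝔭 ∈ PPset K M) :
    (toTH K (logVec K (posGen 𝔭 : K))).1 = Real.log (Ideal.absNorm 𝔭 : ℝ) / d := by
  obtain ⟨h0, -, heq⟩ := posGen_spec (mem_PPset.1 h𝔭).2.1
  rw [toTH_fst_eq_log_absNorm h0, ← heq]

end Literature.NumberTheory.Sieve.ThetaUnits
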